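import Summits.BirchSwinnertonDyer.BirchSwinnertonDyer.Theorems.Rank1ResidualIntModelReduction
import Summits.BirchSwinnertonDyer.Rank1Residual.AdditivePotMult.QuadraticBaseChangeOddTamagawaUnits
import Literature.NumberTheory.EllipticCurves.Rank1Residual.X11RankOneCertificates.Minimality
import Literature.NumberTheory.EllipticCurves.ComplexMultiplicationTwistIsogenyProofs
import Literature.NumberTheory.DiophantineGeometry.LocalReductionProofs
import HarnessLib

/-!
# ROUTE U — reduction of the twists `49a1^{(D)}`, `D ≡ 1 (mod 4)`: good away from `7D`

bsd-cm cell, ROUTE U (Theorem U: BSD(49a1^{(D)}, 7) ⇒ full BSD on `𝒞₇`). Kriz–Li Thm. 1.20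
hypothesis (3) quantifies over the ADDITIVE primes `ℓ ≠ p` of the curve; for a curve `W/ℚ` with
`C • W = 49a1^{(D)}` (`D ≡ 1 (mod 4)`) this file proves that `W` has good reduction at every prime
`ℓ ∤ 7D`, INCLUDING `ℓ = 2` (`hasGoodReductionAtPrime_of_twist_cm7`): `49a1` is good at `ℓ ≠ 7`
(`Δ_min = −7³`), good reduction persists under the unit twist `D = 4k+1` at every residue
characteristic (tree `AdditivePotMult.hasGoodReductionAt_quadraticTwist_of_emod_four`, Silverman
VII.1 Rem. 1.1 / VII.5 Prop. 5.1(a)) and is invariant under `C`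
(`hasGoodReductionAt_smul_iff_holds`). Hence every bad prime `ℓ ≠ 7` of `W` divides `D`
(`dvd_of_not_hasGoodReductionAtPrime_twist_cm7`); for `D = −11` the only candidate is `ℓ = 11`
(`eq_eleven_of_not_hasGoodReductionAtPrime_twist_cm7_D11`) — the domain of hypothesis (3) for the
curve `5929 = 7²·11²` of ROUTE U's first residual discriminant.

THEOREMS ONLY; no new definitions, no named facts.
-/

noncomputable section

open scoped Classical
open NumberField IsDedekindDomain IsDedekindDomain.HeightOneSpectrum WeierstrassCurve
open Literature.NumberTheory.EllipticCurves

namespace Summit.BirchSwinnertonDyer.Rank1Residual.X12.O11.RouteU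

/-- **Good reduction of the twists of `49a1` away from `7D`.** For `W/ℚ` with
`C • W = 49a1^{(D)}`, `D ≡ 1 (mod 4)`, and a prime `ℓ ≠ 7`, `ℓ ∤ D` (the prime `ℓ = 2` included),
`W` has good reduction at `ℓ`. [cite: SilvermanAEC2009, VII.1 Remark 1.1 and VII.5 Prop. 5.1(a)]
[cite: Cremona1997, Table 1 (curve 49a1: Δ = −7³)] -/
theorem hasGoodReductionAtPrime_of_twist_cm7 (W : WeierstrassCurve ℚ) [W.IsElliptic] {D : ℤ}
    (hD4 : D % 4 = 1) (hW : ∃ C : VariableChange ℚ, C • W = cm7.quadraticTwist (D : ℚ))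
    (ℓ : ℕ) [hℓ : Fact ℓ.Prime] (h7 : ℓ ≠ 7) (hℓD : ¬ (ℓ : ℤ) ∣ D) :
    W.HasGoodReductionAtPrime ℓ := by
  obtain ⟨C, hC⟩ := hW
  -- `49a1 = [1, −1, 0, −2, −1]` is globally minimal: no `q¹² ∣ Δ = −343`
  -- (tree `RouteU.isGloballyMinimal_X049_eq`, inlined to keep this file's imports built)
  haveI hmin7 : cm7.IsGloballyMinimal :=
    Rank1Residual.X11RankOneCertificates.isGloballyMinimal_of_int_criterion 1 (-1) 0 (-2) (-1)
      fun q hq ⟨hΔ, _⟩ => by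
        have hD : Rank1Residual.X11RankOneCertificates.discOf [1, -1, 0, -2, -1] = -343 := by
          decide +kernel
        rw [hD, dvd_neg] at hΔ
        have h1 : q ^ 12 ∣ 343 := by exact_mod_cast Int.natAbs_dvd_natAbs.mpr hΔ
        have h2 : q ^ 12 ≤ 343 := Nat.le_of_dvd (by norm_num) h1
        have h3 : 2 ^ 12 ≤ q ^ 12 := Nat.pow_le_pow_left hq.two_le 12
        omega
  -- `49a1` is good at `ℓ ≠ 7` (tree `RouteU.hasGoodReductionAtPrime_cm7`, inlined likewise)
  have hgood7 : cm7.HasGoodReductionAtPrime ℓ := by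
    have hI : integralModelInt cm7 = ⟨1, -1, 0, -2, -1⟩ :=
      Summit.BirchSwinnertonDyer.BirchSwinnertonDyer.Rank1Residual.IntModel.integralModelInt_eq_of_map_eq
        _ (Summit.BirchSwinnertonDyer.BirchSwinnertonDyer.Rank1Residual.IntModel.map_mk_int
          1 (-1) 0 (-2) (-1))
    have hmin : minimalDiscriminantInt cm7 = -343 := by
      rw [Summit.BirchSwinnertonDyer.BirchSwinnertonDyer.Rank1Residual.IntModel.minimalDiscriminantInt_eq
        hI]
      simp only [WeierstrassCurve.Δ, WeierstrassCurve.b₂, WeierstrassCurve.b₄, WeierstrassCurve.b₆,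
        WeierstrassCurve.b₈]
      norm_num
    refine hasGoodReductionAtPrime_of_not_dvd cm7 ℓ ?_
    rw [hmin, dvd_neg, show (343 : ℤ) = 7 ^ 3 by norm_num]
    intro h
    have h' : (ℓ : ℤ) ∣ 7 := (Nat.prime_iff_prime_int.mp hℓ.out).dvd_of_dvd_pow h
    have h'' : ℓ ∣ 7 := by exact_mod_cast h'
    exact h7 ((Nat.prime_dvd_prime_iff_eq hℓ.out (by norm_num)).mp h'')
  -- pass to the place `v` of `ℚ` over `ℓ`
  obtain ⟨v, rfl⟩ : ∃ v : HeightOneSpectrum (𝓞 ℚ), (Rat.HeightOneSpectrum.primesEquiv v : ℕ) = ℓ :=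
    ⟨Rat.HeightOneSpectrum.primesEquiv.symm ⟨ℓ, hℓ.out⟩, by rw [Equiv.apply_symm_apply]⟩
  have hgood7v : cm7.HasGoodReductionAt v :=
    (hasGoodReductionAtPrime_iff_hasGoodReductionAt_ringOfIntegers v cm7).mp hgood7
  -- the unit twist is good at `v` (any residue characteristic), and good reduction is `C`-invariant
  have htw : (cm7.quadraticTwist (D : ℚ)).HasGoodReductionAt v :=
    AdditivePotMult.hasGoodReductionAt_quadraticTwist_of_emod_four cm7 v hD4 hℓD hgood7v
  have hCW : (C • W).HasGoodReductionAt v := by rw [hC]; exact htw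
  have hWv : W.HasGoodReductionAt v := (hasGoodReductionAt_smul_iff_holds v W C).mp hCW
  exact (hasGoodReductionAtPrime_iff_hasGoodReductionAt_ringOfIntegers v W).mpr hWv

/-- **Every bad prime `ℓ ≠ 7` of a twist `49a1^{(D)}` (`D ≡ 1 (mod 4)`) divides `D`** — the
domain of Kriz–Li Thm. 1.20 hypothesis (3) for ROUTE U.
[cite: SilvermanAEC2009, VII.5 Prop. 5.1(a)] [cite: KrizLi2019, Thm. 1.20 (3) (p. 7)] -/
theorem dvd_of_not_hasGoodReductionAtPrime_twist_cm7 (W : WeierstrassCurve ℚ) [W.IsElliptic]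
    {D : ℤ} (hD4 : D % 4 = 1) (hW : ∃ C : VariableChange ℚ, C • W = cm7.quadraticTwist (D : ℚ))
    (ℓ : ℕ) [Fact ℓ.Prime] (h7 : ℓ ≠ 7) (hbad : ¬ W.HasGoodReductionAtPrime ℓ) : (ℓ : ℤ) ∣ D := by
  by_contra hℓD
  exact hbad (hasGoodReductionAtPrime_of_twist_cm7 W hD4 hW ℓ h7 hℓD)

/-- **`D = −11`: the only possible bad prime `ℓ ≠ 7` of `49a1^{(−11)}` (conductor `5929 = 7²·11²`)
is `ℓ = 11`.** [cite: KrizLi2019, Thm. 1.20 (3) (p. 7)] -/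
theorem eq_eleven_of_not_hasGoodReductionAtPrime_twist_cm7_D11 (W : WeierstrassCurve ℚ)
    [W.IsElliptic] (hW : ∃ C : VariableChange ℚ, C • W = cm7.quadraticTwist ((-11 : ℤ) : ℚ))
    (ℓ : ℕ) [hℓ : Fact ℓ.Prime] (h7 : ℓ ≠ 7) (hbad : ¬ W.HasGoodReductionAtPrime ℓ) : ℓ = 11 := by
  have hd : (ℓ : ℤ) ∣ (-11 : ℤ) :=
    dvd_of_not_hasGoodReductionAtPrime_twist_cm7 W (by decide) hW ℓ h7 hbad
  rw [dvd_neg] at hd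
  have hd' : ℓ ∣ 11 := by exact_mod_cast hd
  exact (Nat.prime_dvd_prime_iff_eq hℓ.out (by norm_num)).mp hd'

/-- **Hypothesis (3) of Kriz–Li Thm. 1.20 for `49a1^{(−11)}` reduces to the single prime `ℓ = 11`:**
if the conclusion `Q ℓ` holds at `ℓ = 11`, it holds at every additive prime `ℓ ≠ 7`.
(The form consumed by `thm120_padicLogHeegner_unit_of_bernoulli`, with `Q ℓ` the conjunction
`ψ(ℓ) ≠ 1 ∧ (ψ⁻¹ω)(ℓ) ≠ 1`.) [cite: KrizLi2019, Thm. 1.20 (3) (p. 7)] -/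
theorem thm120_hyp3_of_eleven_D11 (W : WeierstrassCurve ℚ) [W.IsElliptic]
    (hW : ∃ C : VariableChange ℚ, C • W = cm7.quadraticTwist ((-11 : ℤ) : ℚ)) (Q : ℕ → Prop)
    (hQ : Q 11) :
    ∀ ℓ : ℕ, (hℓ : ℓ.Prime) → ℓ ≠ 7 →
      (haveI := Fact.mk hℓ;
        ¬ W.HasGoodReductionAtPrime ℓ ∧ ¬ W.HasMultiplicativeReductionAtPrime ℓ) → Q ℓ := by
  intro ℓ hℓ h7 hbad
  haveI := Fact.mk hℓ
  rw [eq_eleven_of_not_hasGoodReductionAtPrime_twist_cm7_D11 W hW ℓ h7 hbad.1]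
  exact hQ

end Summit.BirchSwinnertonDyer.Rank1Residual.X12.O11.RouteU

end
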